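import Mathlib
import HarnessLib
import Literature.MathematicalPhysics.QuantumLattice.GroundStateSourceBounds
import Summits.HubbardSuperconductivity.HubbardSuperconductivity.Theorems.WeakCouplingBCSWcbcsBcsConstructionTrialStateSectors

/-!
# Route `WeakCouplingBCS`, support item `WcbcsLegendreCeiling` (stmt-HubbardSuperconductivity-1197):
# the Koma–Tasaki trial state of a SECTOR eigenvector against a sourced comparison Hamiltonian

Helper file (`--supports stmt-HubbardSuperconductivity-1197`). Pure finite-dimensional matrix
analysis, continuing `WeakCouplingBCSWcbcsBcsConstructionTrialStateSectors.lean` (namespace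
`WcbcsTrialState`: selection rules from a conserved charge, the variational principle for an
unnormalised trial vector, the identity `2OHO = O²H + HO² - [O,[O,H]]`).

For Hermitian `H` ("interacting Hamiltonian"), `Nn` ("particle number", `[Nn, H] = 0`), a positive
`P` ("repulsion"), a charged `X` (`[Nn, X] = -2X`) with order operator `O = X + Xᴴ`, and a unit
vector `ψ` with `Nn ψ = a ψ`, `H ψ = E ψ` and `q = ‖Oψ‖² > 0`, the trial vector `Ξ = ψ + Oψ/√q`
(`‖Ξ‖² = 2`, `⟨Ξ, OΞ⟩ = 2√q`, `⟨Ξ, HΞ⟩ ≤ 2E + ‖[O,[O,H]]‖/(2q)`, `|⟨Ξ, Nn Ξ⟩ - 2a| ≤ 2`,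
`⟨Ξ, PΞ⟩ ≥ 0`) tested against the comparison Hamiltonian `K = H - U P - μ Nn - h O` (`U ≥ 0`)
gives the **tower trial-state budget**

  `h √q ≤ E - μ a + |μ| + ‖[O,[O,H]]‖/(4q) - E₀(K)`

(`sector_trial_bound`). This is Koma–Tasaki, J. Stat. Phys. 76 (1994) 745, proof of Theorem 2.2,
eq. (2.9), for an eigenvector of `H` that need not be a ground state (a sector ground state in the
application), with the repulsion dropped by positivity and the chemical-potential term controlled
by the charge `±2` of `O`. No definitions; everything is proved.
-/

set_option linter.dupNamespace false

namespace Summit.HubbardSuperconductivity.HubbardSuperconductivity.Theorems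

open Literature.MathematicalPhysics.QuantumLattice Matrix
open scoped Matrix.Norms.L2Operator ComplexOrder

namespace WcbcsLegendre

open WcbcsTrialState

variable {m : Type*} [Fintype m]

/-- Number expectation of the charged image: for `Φ = (X + Xᴴ)ψ` with `[Nn, X] = -2X`, `Nn ψ = aψ`,
`Re⟨Φ, Nn Φ⟩` differs from `a ‖Φ‖²` by at most `2‖Φ‖²` (`Xψ` and `Xᴴψ` are orthogonal
`Nn`-eigenvectors with eigenvalues `a ∓ 2`). [folklore] -/
theorem abs_re_number_charged_sub_le {Nn X : Matrix m m ℂ} (hNn : Nn.IsHermitian)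
    (hX : Nn * X - X * Nn = ((-2 : ℝ) : ℂ) • X) {ψ : m → ℂ} {a : ℝ}
    (hNψ : Nn *ᵥ ψ = (a : ℂ) • ψ) :
    |(star ((X + Xᴴ) *ᵥ ψ) ⬝ᵥ (Nn *ᵥ ((X + Xᴴ) *ᵥ ψ))).re -
        a * (star ((X + Xᴴ) *ᵥ ψ) ⬝ᵥ ((X + Xᴴ) *ᵥ ψ)).re| ≤
      2 * (star ((X + Xᴴ) *ᵥ ψ) ⬝ᵥ ((X + Xᴴ) *ᵥ ψ)).re := by
  have hX' := commutator_conjTranspose_of_commutator hNn hX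
  have hm := eigen_mulVec_of_commutator hX hNψ
  have hp := eigen_mulVec_of_commutator hX' hNψ
  have h34 := star_dotProduct_eq_zero_of_eigen hNn hm hp (by linarith)
  have h43 := star_dotProduct_eq_zero_of_eigen hNn hp hm (by linarith)
  set vm := X *ᵥ ψ with hvm
  set vp := Xᴴ *ᵥ ψ with hvp
  have hsplit : (X + Xᴴ) *ᵥ ψ = vm + vp := add_mulVec _ _ _
  have hnm : star vm ⬝ᵥ vm = ((eucNorm vm ^ 2 : ℝ) : ℂ) := star_dotProduct_self_eq_eucNorm_sq vm
  have hnp : star vp ⬝ᵥ vp = ((eucNorm vp ^ 2 : ℝ) : ℂ) := star_dotProduct_self_eq_eucNorm_sq vp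
  have hN : Nn *ᵥ (vm + vp) = ((a + -2 : ℝ) : ℂ) • vm + ((a + - -2 : ℝ) : ℂ) • vp := by
    rw [mulVec_add, hm, hp]
  have h1 : star (vm + vp) ⬝ᵥ (Nn *ᵥ (vm + vp)) =
      ((a + -2 : ℝ) : ℂ) * ((eucNorm vm ^ 2 : ℝ) : ℂ) + ((a + - -2 : ℝ) : ℂ) * ((eucNorm vp ^ 2 : ℝ) : ℂ) := by
    rw [hN, star_add, add_dotProduct, dotProduct_add, dotProduct_add, dotProduct_smul, dotProduct_smul,
      dotProduct_smul, dotProduct_smul, h34, h43, hnm, hnp, smul_eq_mul, smul_eq_mul, smul_eq_mul,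
      smul_eq_mul, mul_zero, mul_zero, add_zero, zero_add]
  have h2 : star (vm + vp) ⬝ᵥ (vm + vp) = ((eucNorm vm ^ 2 : ℝ) : ℂ) + ((eucNorm vp ^ 2 : ℝ) : ℂ) := by
    rw [star_add, add_dotProduct, dotProduct_add, dotProduct_add, h34, h43, hnm, hnp, add_zero, zero_add]
  rw [hsplit, h1, h2]
  have e1 : (((a + -2 : ℝ) : ℂ) * ((eucNorm vm ^ 2 : ℝ) : ℂ) +
      ((a + - -2 : ℝ) : ℂ) * ((eucNorm vp ^ 2 : ℝ) : ℂ)).re =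
      (a - 2) * eucNorm vm ^ 2 + (a + 2) * eucNorm vp ^ 2 := by
    simp only [Complex.add_re, ← Complex.ofReal_mul, Complex.ofReal_re]
    ring
  have e2 : (((eucNorm vm ^ 2 : ℝ) : ℂ) + ((eucNorm vp ^ 2 : ℝ) : ℂ)).re = eucNorm vm ^ 2 + eucNorm vp ^ 2 := by
    simp only [Complex.add_re, Complex.ofReal_re]
  rw [e1, e2, abs_le]
  constructor <;> nlinarith [sq_nonneg (eucNorm vm), sq_nonneg (eucNorm vp)]

variable [DecidableEq m]

/-- **The tower trial-state budget** (Koma–Tasaki lite, for a sector eigenvector). Let `H`, `Nn` be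
Hermitian with `[Nn, H] = 0`, `P ≥ 0`, `[Nn, X] = -2X`, `O = X + Xᴴ`, and `ψ` a unit vector with
`Nn ψ = aψ`, `H ψ = Eψ`, `q = ‖Oψ‖² > 0`. Then for `U ≥ 0` and all real `μ`, `h`,
`h √q ≤ E - μ a + |μ| + ‖[O,[O,H]]‖/(4q) - E₀(H - U P - μ Nn - h O)`:
the trial vector `Ξ = ψ + Oψ/√q` has `‖Ξ‖² = 2`, `⟨Ξ,OΞ⟩ = 2√q`,
`⟨Ξ,HΞ⟩ ≤ 2E + ‖[O,[O,H]]‖/(2q)` (double-commutator identity for the eigenvector `ψ`),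
`⟨Ξ,PΞ⟩ ≥ 0` and `⟨Ξ, Nn Ξ⟩ ∈ [2a - 2, 2a + 2]` (the charge `±2` of `O`).
[cite: KomaTasaki1994, Theorem 2.2] -/
theorem sector_trial_bound [Nonempty m] {H P Nn X : Matrix m m ℂ} (hH : H.IsHermitian)
    (hNn : Nn.IsHermitian) (hP : P.PosSemidef) (hX : Nn * X - X * Nn = ((-2 : ℝ) : ℂ) • X)
    (hNH : Nn * H - H * Nn = ((0 : ℝ) : ℂ) • H) {ψ : m → ℂ} (hψ : star ψ ⬝ᵥ ψ = 1) {a E : ℝ}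
    (hNψ : Nn *ᵥ ψ = (a : ℂ) • ψ) (hHψ : H *ᵥ ψ = (E : ℂ) • ψ) {U μ h : ℝ} (hU : 0 ≤ U)
    (hq : 0 < (star ((X + Xᴴ) *ᵥ ψ) ⬝ᵥ ((X + Xᴴ) *ᵥ ψ)).re) :
    h * Real.sqrt (star ((X + Xᴴ) *ᵥ ψ) ⬝ᵥ ((X + Xᴴ) *ᵥ ψ)).re ≤
      E - μ * a + |μ| +
        ‖(X + Xᴴ) * ((X + Xᴴ) * H - H * (X + Xᴴ)) - ((X + Xᴴ) * H - H * (X + Xᴴ)) * (X + Xᴴ)‖ /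
          (4 * (star ((X + Xᴴ) *ᵥ ψ) ⬝ᵥ ((X + Xᴴ) *ᵥ ψ)).re) -
        (H - (U : ℂ) • P - (μ : ℂ) • Nn - (h : ℂ) • (X + Xᴴ)).groundEnergy := by
  set O := X + Xᴴ with hOdef
  have hO : O.IsHermitian := isHermitian_add_transpose_self X
  set Φ := O *ᵥ ψ with hΦ
  set D := O * (O * H - H * O) - (O * H - H * O) * O with hD
  set q : ℝ := (star Φ ⬝ᵥ Φ).re with hqdef
  have hΦΦ : star Φ ⬝ᵥ Φ = (q : ℂ) := by
    rw [hqdef, star_dotProduct_self_eq_eucNorm_sq Φ, Complex.ofReal_re]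
  have hq_pos : 0 < q := hq
  -- selection rules
  have hV1 : star ψ ⬝ᵥ (O *ᵥ ψ) = 0 := star_dotProduct_charged_mulVec_eq_zero hNn hX hNψ
  have hV2 : star (H *ᵥ ψ) ⬝ᵥ (O *ᵥ ψ) = 0 :=
    star_mulVec_dotProduct_charged_mulVec_eq_zero hNn hX hNH hNψ
  have hV3 : star (O *ᵥ ψ) ⬝ᵥ (O *ᵥ (O *ᵥ ψ)) = 0 := star_charged_mulVec_dotProduct_eq_zero hNn hX hNψ
  have hΦΨ : star Φ ⬝ᵥ ψ = 0 := by
    rw [hΦ, ← star_dotProduct_mulVec_of_isHermitian hO]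
    exact hV1
  have hΨOΦ : star ψ ⬝ᵥ (O *ᵥ Φ) = (q : ℂ) := by
    rw [star_dotProduct_mulVec_of_isHermitian hO, ← hΦ, hΦΦ]
  have hΦOΨ : star Φ ⬝ᵥ (O *ᵥ ψ) = (q : ℂ) := by rw [← hΦ, hΦΦ]
  have hΨHΦ : star ψ ⬝ᵥ (H *ᵥ Φ) = 0 := by
    rw [star_dotProduct_mulVec_of_isHermitian hH]
    exact hV2
  have hΦHΨ : star Φ ⬝ᵥ (H *ᵥ ψ) = 0 := by
    have h0 := congrArg star hV2
    rwa [← star_dotProduct_star, star_star, star_zero] at h0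
  -- number bookkeeping
  have hΨNΨ : star ψ ⬝ᵥ (Nn *ᵥ ψ) = (a : ℂ) := by
    rw [hNψ, dotProduct_smul, hψ, smul_eq_mul, mul_one]
  have hΨNΦ : star ψ ⬝ᵥ (Nn *ᵥ Φ) = 0 := by
    rw [star_dotProduct_mulVec_of_isHermitian hNn, hNψ, star_smul, smul_dotProduct, hΦ, hV1, smul_zero]
  have hΦNΨ : star Φ ⬝ᵥ (Nn *ᵥ ψ) = 0 := by
    rw [hNψ, dotProduct_smul, hΦΨ, smul_zero]
  have hΦNΦ := abs_re_number_charged_sub_le hNn hX hNψ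
  rw [← hOdef, ← hΦ, ← hqdef] at hΦNΦ
  -- the trial vector
  set c : ℝ := 1 / Real.sqrt q with hc
  have hsq : Real.sqrt q ^ 2 = q := Real.sq_sqrt hq_pos.le
  have hsqpos : 0 < Real.sqrt q := Real.sqrt_pos.2 hq_pos
  have hcq : c * q = Real.sqrt q := by
    rw [hc]; field_simp; rw [hsq]
  have hc2q : c ^ 2 * q = 1 := by
    rw [hc]; field_simp; rw [hsq]
  set Ξ := ψ + (c : ℂ) • Φ with hΞ
  have hΞΞ : (star Ξ ⬝ᵥ Ξ).re = 2 := by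
    have h1 := star_dotProduct_mulVec_add_smul 1 ψ Φ c
    simp only [one_mulVec] at h1
    rw [hΞ, h1, hψ, hV1, hΦΨ, hΦΦ]
    simp only [mul_zero, add_zero, Complex.add_re, Complex.one_re]
    rw [← Complex.ofReal_pow, ← Complex.ofReal_mul, Complex.ofReal_re, hc2q]
    norm_num
  have hΞOΞ : (star Ξ ⬝ᵥ (O *ᵥ Ξ)).re = 2 * Real.sqrt q := by
    rw [hΞ, star_dotProduct_mulVec_add_smul O ψ Φ c, hV1, hΨOΦ, hΦOΨ, hV3, mul_zero, add_zero,
      zero_add, ← Complex.ofReal_mul, ← Complex.ofReal_add, Complex.ofReal_re, hcq]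
    ring
  have hΨHΨ : (star ψ ⬝ᵥ (H *ᵥ ψ)).re = E := by
    rw [hHψ, dotProduct_smul, hψ, smul_eq_mul, mul_one, Complex.ofReal_re]
  have hΞHΞ : (star Ξ ⬝ᵥ (H *ᵥ Ξ)).re = E + c ^ 2 * (star Φ ⬝ᵥ (H *ᵥ Φ)).re := by
    rw [hΞ, star_dotProduct_mulVec_add_smul H ψ Φ c, hΨHΦ, hΦHΨ, mul_zero, add_zero, add_zero,
      Complex.add_re, ← Complex.ofReal_pow, Complex.re_ofReal_mul, hΨHΨ]
  have hΞNΞ : (star Ξ ⬝ᵥ (Nn *ᵥ Ξ)).re = a + c ^ 2 * (star Φ ⬝ᵥ (Nn *ᵥ Φ)).re := by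
    rw [hΞ, star_dotProduct_mulVec_add_smul Nn ψ Φ c, hΨNΦ, hΦNΨ, mul_zero, add_zero, add_zero,
      Complex.add_re, ← Complex.ofReal_pow, Complex.re_ofReal_mul, hΨNΨ, Complex.ofReal_re]
  have hΞPΞ : 0 ≤ (star Ξ ⬝ᵥ (P *ᵥ Ξ)).re := by
    have := hP.re_dotProduct_nonneg Ξ
    rwa [RCLike.re_to_complex] at this
  -- `Re⟨Φ, HΦ⟩ ≤ E q + ‖D‖/2`
  have hsand := two_mul_re_sandwich_eq hH hO ψ
  rw [← hΦ, ← hD] at hsand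
  have hOOH : (star (O *ᵥ Φ) ⬝ᵥ (H *ᵥ ψ)).re = E * q := by
    rw [hHψ, dotProduct_smul, ← star_dotProduct_mulVec_of_isHermitian hO, hΦOΨ, smul_eq_mul,
      ← Complex.ofReal_mul, Complex.ofReal_re]
  have hDv : -(star ψ ⬝ᵥ (D *ᵥ ψ)).re ≤ ‖D‖ := by
    have h1 := re_star_dotProduct_mulVec_le (-D) ψ
    rwa [neg_mulVec, dotProduct_neg, Complex.neg_re, norm_neg, eucNorm_eq_one hψ, one_pow,
      mul_one] at h1
  have hP' : (star Φ ⬝ᵥ (H *ᵥ Φ)).re ≤ E * q + ‖D‖ / 2 := by linarith [hsand, hOOH, hDv]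
  -- the comparison Hamiltonian and the variational principle
  set K := H - (U : ℂ) • P - (μ : ℂ) • Nn - (h : ℂ) • O with hK
  have hKh : K.IsHermitian :=
    isHermitian_sub_real_smul (isHermitian_sub_real_smul (isHermitian_sub_real_smul hH hP.1 U) hNn μ) hO h
  have hvar := groundEnergy_mul_le_re hKh Ξ
  have hKΞ : (star Ξ ⬝ᵥ (K *ᵥ Ξ)).re = (star Ξ ⬝ᵥ (H *ᵥ Ξ)).re - U * (star Ξ ⬝ᵥ (P *ᵥ Ξ)).re -
      μ * (star Ξ ⬝ᵥ (Nn *ᵥ Ξ)).re - h * (star Ξ ⬝ᵥ (O *ᵥ Ξ)).re := by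
    rw [hK]
    simp only [sub_mulVec, smul_mulVec, dotProduct_sub, dotProduct_smul, smul_eq_mul, Complex.sub_re,
      Complex.re_ofReal_mul]
  rw [hKΞ, hΞΞ, hΞOΞ, hΞHΞ, hΞNΞ] at hvar
  -- assemble
  have hstep : c ^ 2 * (star Φ ⬝ᵥ (H *ᵥ Φ)).re ≤ E + ‖D‖ * c ^ 2 / 2 := by
    have h1 := mul_le_mul_of_nonneg_left hP' (sq_nonneg c)
    have h2 : c ^ 2 * (E * q + ‖D‖ / 2) = E * (c ^ 2 * q) + ‖D‖ * c ^ 2 / 2 := by ring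
    rw [h2, hc2q, mul_one] at h1
    exact h1
  have hnum : -(μ * (c ^ 2 * (star Φ ⬝ᵥ (Nn *ᵥ Φ)).re)) ≤ -(μ * a) + 2 * |μ| := by
    have h1 : |c ^ 2 * (star Φ ⬝ᵥ (Nn *ᵥ Φ)).re - a| ≤ 2 := by
      have h2 : c ^ 2 * (star Φ ⬝ᵥ (Nn *ᵥ Φ)).re - a =
          c ^ 2 * ((star Φ ⬝ᵥ (Nn *ᵥ Φ)).re - a * q) := by
        have : a = a * (c ^ 2 * q) := by rw [hc2q, mul_one]
        conv_lhs => rw [this]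
        ring
      rw [h2, abs_mul, abs_of_nonneg (sq_nonneg c)]
      calc c ^ 2 * |(star Φ ⬝ᵥ (Nn *ᵥ Φ)).re - a * q| ≤ c ^ 2 * (2 * q) :=
            mul_le_mul_of_nonneg_left hΦNΦ (sq_nonneg c)
        _ = 2 := by linear_combination 2 * hc2q
    have h3 := abs_mul μ (c ^ 2 * (star Φ ⬝ᵥ (Nn *ᵥ Φ)).re - a)
    have h4 : |μ| * |c ^ 2 * (star Φ ⬝ᵥ (Nn *ᵥ Φ)).re - a| ≤ |μ| * 2 :=
      mul_le_mul_of_nonneg_left h1 (abs_nonneg μ)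
    have h5 := neg_abs_le (μ * (c ^ 2 * (star Φ ⬝ᵥ (Nn *ᵥ Φ)).re - a))
    nlinarith [h3, h4, h5]
  have hUP : 0 ≤ U * (star Ξ ⬝ᵥ (P *ᵥ Ξ)).re := mul_nonneg hU hΞPΞ
  have hDc : ‖D‖ * c ^ 2 / 2 = ‖D‖ / (4 * q) * 2 := by
    have hc2 : c ^ 2 = 1 / q := by
      field_simp
      linear_combination hc2q
    rw [hc2]
    field_simp
    ring
  have hfin : 2 * (h * Real.sqrt q) ≤ 2 * (E - μ * a + |μ| + ‖D‖ / (4 * q) - K.groundEnergy) := by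
    nlinarith [hvar, hstep, hnum, hUP, hDc]
  linarith

end WcbcsLegendre

end Summit.HubbardSuperconductivity.HubbardSuperconductivity.Theorems
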